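import Literature.MathematicalPhysics.QuantumFieldTheory.Balaban1983to89.B6HolderPairMemberV1

/-!
# `Balaban1983to89.B6CubeHolderInDecayV1` — T. Bałaban, *Propagators and renormalization transformations for lattice gauge theories. II*,
# Commun. Math. Phys. **96** (1984) 223–250 [Balaban1984PropagatorsII], Prop. 2.6 (2.137) p. 247 with (2.133) p. 247 / Prop. 2.5 p. 246: THE HÖLDER
# FIRST LEG OF THE WALK (2.141) — STEP 2: THE PAIR MAJORANT OF `∇_νG_□` OF THE CUBE ON THE GLOBAL V1 TORUS (`hHEGin_cube`: the member's [4] (1.111)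
# pair bound carried through r03's window transplant and chart translation, input-localised over `□⁺`, outputs anywhere, print's prefactor)

statement-level skeleton of published theorems with citation tags; proofs where landed; nothing here is a claim about the Yang–Mills mass gap

PDF held: `paper:balaban1984-cmp96-propagators-rt-ii` (journal page = PDF page + 222), p. 247 [PDF 25] (×2 render re-read this generation):
*"|(G_□J)(x)|, |(∇G_□J)(x)| ≤ O(1)[(Lʲη)², Lʲη]e^{−δ₂(Lʲη)^{−1}dist(Δ,Δ′)}|J| (2.133) for x ∈ Δ(y), supp J ⊂ Δ(y′), y, y′ ∈ 𝔅 ∩ T_□"*;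
*"‖ζ∇GJ‖_α, ‖ζG∇*J‖_α ≤ O(1)(Lʲη)^{1−α}(‖ζ‖^ξ_α + |ζ|)e^{−δ₃d(y,y′)}|J|, ξ = L^{−j} (2.137)"*; *"G = … = Σ_ω h_{□₀}G_{□₀}h_{□₀}K_{□₁,□₂}… (2.141) … convergent
in the norms appearing in the inequalities (2.136)–(2.140)"*; p. 246 [PDF 24] Prop. 2.5: the member satisfies [4] (1.111) with `δ₂`.

CITATION HEADER (lean-in-tree rule) — WHAT IS REPRODUCED.  Phase-2 file of the `lit-balaban` typed skeleton (HOME `run/shared/lean/pub/lit-balaban/`),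
seat **p22 gen 26** (free target (2.137)₁ at k levels, protocol G.5-34(d), TAKING HOME/STATUS.md 2026-08-23T22:15Z; r03 no objection 22:25Z); SKELETON
rows **B6.Prop2.6** × B6.Eq2.133 × B6.Prop2.5 (cells only).  The Hölder analogue of r03's `…B6CubeInDecayV1.hEGin_cube` (SAME script): the member's pair
majorant `P_{b₁,b₂}·∇_λG_□ ≤ C_α t^α e^{−δ₂|y−y′|}` on `T_□` (this seat's `…B6HolderPairMemberV1.holder2137_member` = p38's/r03's [4] (1.111) member)
carried through r03's band bridge `…B6InDecayWindowV1.inDecay_window_V1` (GENERIC in the member operator), the unit `s(□)⁻¹ ≤ (L^{j(y)}/c′)²`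
(`sc_inv_le_pref`), and the chart translation `inMajorant_conj_chart`, with the operator identity of §1:
* §1 **`pairOp_translate_mul_EC_mul_Gl_eq`** — for window bonds `c₁, c₂` of the cube's chart frame,
  `P_{c₁+v, c₂+v}·(E_(ν,+)·G_□) = τ_{−v}·(P_{c₁,c₂}·(s(□)⁻¹•ε(∇_νG_t)ρ))·τ_v = τ_{−v}·(s(□)⁻¹•ε(P_{e c₁, e c₂}·∇_νG_t)ρ)·τ_v` (r03's `EC_mul_Gl_eq` +
  this seat's `TB_neg_mul_pairOp_mul_TB` / `transplant_pairOp_mul`): the global pair difference of the leg `E_(ν,+)G_□` IS the transplant of the member's;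
  (and `pairOp_translate_mul_Gl_eq`, the same for `G_□` itself);
* §2 **`hHEGin_cube`** — THE PAIR MAJORANT OF `∇_νG_□` OF THE CUBE: there is `δ_H > 0` and for every `0 ≤ α < 1` a `C_H ≥ 0` (on `d, L, a₀, a₁, α`) such
  that for every admissible V1 torus, cube `□` (placed), weights, fine factor `c′`, direction `ν` and window bonds `c₁, c₂` of the same direction whose
  charted initial points are at sup-distance `≤ L^{j_t}` on `T_□`:
  `InMajorant (geomT D) (blkV1 hN D) (P_{c₁+v,c₂+v}·(E_(ν,+)·G_□)) (□⁺) (C_H·t^α·(L^{j(y)}/c′)²·e^{−δ_H d_T(y,y′)})`, `t = |e c₁ − e c₂|_∞/L^{j_t}`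
  — inputs over `□⁺`, outputs ANYWHERE; the sup twin is `hEGin_cube` (kernel `C_G·(L^{j(y)}/c′)²·e^{−δ_G d_T}`); **`hHGin_cube`** — the pair
  majorant of `G_□` itself, kernel `C_H·t·(L^{j(y)}/c′)²·e^{−δ_H d_T}` (this seat's `holderG_member`: Lipschitz in the output from p22's (1.110)₂).
IMPORTS BY NAME, restating nothing; THEOREMS ONLY (no `def`, no `def … : Prop`, no new hypothesis); standard axioms.

HONEST SCOPE / DIVERGENCES.  (1) As `hEGin_cube`: `L ≥ 5` (band `C = 9`), `M_h ≥ 2`, `R ≥ 2L²`, placed cube; the prefactor `(L^{j(y)}/c′)²` is that of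
the leg `E_(ν,+)G_□` (the unit `s(□)` sits in p38's coefficient `(c′/L^{j₀})`, which turns it into print's `Lʲη` in the product rule — next file).
(2) The pair is given in the CHART FRAME of the cube (`c₁, c₂` window bonds, the global bonds are `c₁ + v`, `c₂ + v`); `t` is measured on `T_□`
(`≤` the global relative distance — next file).  (3) This is ONE factor of the Hölder first leg; the product rule with `h_□` (Lipschitz and mixed second
differences of the fine partition), the placement of the output block in `□̃` and the final (2.137)₁ are the next files.  Integer tori, lattice units;
nothing on d = 4 specifically or the continuum; NOT summit progress.  Unit `lit-balaban-p22` (gen 26), 2026-08-23.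
-/

noncomputable section

open scoped BigOperators
open Finset

namespace Literature.MathematicalPhysics.QuantumFieldTheory.Balaban1983to89.B6CubeHolderInDecayV1

open LatticeFieldCalculus
open B5Eq118OneStroke (iterBlockOf)
open B4Reflection242 (boxDom)
open B6MultiLevelBoxOperator (N0)
open B6MultiLevelTorusOperator (TDomains)
open B6Eq238MultiLevelTorus (svec)
open B6Cover236MultiLevelBlocks (cubes)
open B6Geom246MultiLevelBox (bset)
open B6Partition118KLevelTorusCentral (one_le_of_four_le)
open B6GlobalChartV1 (PV toBox blkV1 domT)
open B6AgreeLapV1Chart (cB eB posV mem_cB_W)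
open B6Prop25TwoScaleCensus (TSIdx)
open B6Prop26KLevelSkeletonV1 (ST pref pref_nonneg)
open B6Geom246MultiLevelTorus (geomT blkMap)
open B6SectAOperatorsV1 (BondIdx)
open B6Ineq2133TwoScaleV1 (onFun tsGeo)
open B6RandomWalk (HasMajorant hasMajorant_mono BlockSupp)
open B6InMajorantTransplant (InMajorant inMajorant_mono inMajorant_congr_set inMajorant_conj_chart)
open B6InDecayWindowV1 (inMajorant_smul_of_le_on inDecay_window_V1)
open B6Prop26ReachTransplant (transplant)
open B6TranslateTorusV1 (vch TB kernel_blkMap)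
open B6Eq292MemberTorusV1 (EC)
open B6CubeWindowV1 (x0 j0 tC sc hx0 hfit Placed wC Gl SQ mem_SQ mem_blkMap_image_SQ)
open B6CubeInDecayV1 (conj_mul Gl_eq EC_mul_Gl_eq hdiv_cube hlev_full hband_cube sc_inv_le_pref transplant_off sc_nonneg smul_kernel_le)
open B6HolderPairMemberV1 (pairOp holder2137_member holderG_member transplant_pairOp_mul TB_neg_mul_pairOp_mul_TB)

variable {d ℓ : ℕ} {hd : 1 ≤ d + 1} {hL : Odd (ℓ + 1) ∧ 1 < ℓ + 1} {a₀ a₁ : ℝ} {m K : ℕ} {Mh k R : ℕ} {P' : Fin (d + 1) → ℕ}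

/-! ## §1  The operator identity: the global pair difference of `E_(ν,+)·G_□` is the conjugated scaled transplant of the member's -/

section Identity

variable (hN : ∀ μ, N0 ℓ Mh k P' μ = (PV d ℓ m K hd hL).sitesPerDir 0) {D : TDomains d ℓ Mh k P' R} (hk : k ≤ m + K)
  (hMh1 : 1 ≤ Mh) (hP4 : ∀ μ, 4 ≤ P' μ) {a : ℕ} (hMha : Mh = (ℓ + 1) ^ a) (c : ↥(cubes D.toDomains)) (ha : a₀ ≤ a₁)

/-- **`P_{c₁+v,c₂+v}·(E_(ν,+)·G_□) = τ_{−v}·(s(□)⁻¹•ε(P_{ec₁,ec₂}·∇_νG_t)ρ)·τ_v`** for window bonds `c₁, c₂` of the chart frame (`v` the chart vector):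
r03's `EC_mul_Gl_eq`, the translation of the pair operator and its passage through the (injective) window transplant.
[cite: Balaban1984PropagatorsII, (2.133) p.247, (2.92) p.239 (line 1), p.238 (T_□ = □̃³); dictionary (charts), derivation ours] -/
theorem pairOp_translate_mul_EC_mul_Gl_eq (hpl : Placed ℓ k P' c.1) (w : BondIdx (domT hN D hk) → ℝ) (cf : ℝ) (ν : Fin (d + 1))
    {c₁ c₂ : PBond (PV d ℓ m K hd hL) 0}
    (hc₁ : c₁ ∈ (cB (tC hN hk hMh1 hP4 c ha a (wC hN hk c w) cf) (x0 ℓ Mh k c.1) (hx0 hpl) (hfit hN hMh1 hP4 hMha c ha hpl)).W)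
    (hc₂ : c₂ ∈ (cB (tC hN hk hMh1 hP4 c ha a (wC hN hk c w) cf) (x0 ℓ Mh k c.1) (hx0 hpl) (hfit hN hMh1 hP4 hMha c ha hpl)).W) :
    pairOp (c₁.translate (vch Mh k (svec ℓ k c.1.1 c.1.2))) (c₂.translate (vch Mh k (svec ℓ k c.1.1 c.1.2))) *
        (EC hN hk hMh1 hP4 hMha c ha hpl w cf (ν, true) * Gl hN hk hMh1 hP4 hMha c ha hpl w cf) =
      TB (-vch Mh k (svec ℓ k c.1.1 c.1.2)) *
        ((sc hMh1 hP4 c cf)⁻¹ • transplant (cB (tC hN hk hMh1 hP4 c ha a (wC hN hk c w) cf) (x0 ℓ Mh k c.1) (hx0 hpl) (hfit hN hMh1 hP4 hMha c ha hpl)).W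
          (eB (tC hN hk hMh1 hP4 c ha a (wC hN hk c w) cf) (x0 ℓ Mh k c.1))
          (pairOp (eB (tC hN hk hMh1 hP4 c ha a (wC hN hk c w) cf) (x0 ℓ Mh k c.1) c₁) (eB (tC hN hk hMh1 hP4 c ha a (wC hN hk c w) cf) (x0 ℓ Mh k c.1) c₂) *
            onFun ((tC hN hk hMh1 hP4 c ha a (wC hN hk c w) cf).Dl ν ∘ₗ (tC hN hk hMh1 hP4 c ha a (wC hN hk c w) cf).D.G))) *
        TB (vch Mh k (svec ℓ k c.1.1 c.1.2)) := by
  rw [EC_mul_Gl_eq, ← TB_neg_mul_pairOp_mul_TB (vch Mh k (svec ℓ k c.1.1 c.1.2)) c₁ c₂, conj_mul, mul_smul_comm,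
    transplant_pairOp_mul (W := (cB (tC hN hk hMh1 hP4 c ha a (wC hN hk c w) cf) (x0 ℓ Mh k c.1) (hx0 hpl) (hfit hN hMh1 hP4 hMha c ha hpl)).W)
      (e := eB (tC hN hk hMh1 hP4 c ha a (wC hN hk c w) cf) (x0 ℓ Mh k c.1))
      (cB (tC hN hk hMh1 hP4 c ha a (wC hN hk c w) cf) (x0 ℓ Mh k c.1) (hx0 hpl) (hfit hN hMh1 hP4 hMha c ha hpl)).inj _ hc₁ hc₂]
  rfl

/-- **`P_{c₁+v,c₂+v}·G_□ = τ_{−v}·(s(□)⁻¹•ε(P_{ec₁,ec₂}·G_t)ρ)·τ_v`** for window bonds `c₁, c₂` (r03's `Gl_eq` + the transport calculus).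
[cite: Balaban1984PropagatorsII, (2.90)–(2.94) p.239, (2.133) p.247, p.238 (T_□ = □̃³); dictionary (charts), derivation ours] -/
theorem pairOp_translate_mul_Gl_eq (hpl : Placed ℓ k P' c.1) (w : BondIdx (domT hN D hk) → ℝ) (cf : ℝ) {c₁ c₂ : PBond (PV d ℓ m K hd hL) 0}
    (hc₁ : c₁ ∈ (cB (tC hN hk hMh1 hP4 c ha a (wC hN hk c w) cf) (x0 ℓ Mh k c.1) (hx0 hpl) (hfit hN hMh1 hP4 hMha c ha hpl)).W) (hc₂ : c₂ ∈ (cB (tC hN hk hMh1 hP4 c ha a (wC hN hk c w) cf) (x0 ℓ Mh k c.1) (hx0 hpl) (hfit hN hMh1 hP4 hMha c ha hpl)).W) :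
    pairOp (c₁.translate (vch Mh k (svec ℓ k c.1.1 c.1.2))) (c₂.translate (vch Mh k (svec ℓ k c.1.1 c.1.2))) * Gl hN hk hMh1 hP4 hMha c ha hpl w cf =
      TB (-vch Mh k (svec ℓ k c.1.1 c.1.2)) *
        ((sc hMh1 hP4 c cf)⁻¹ • transplant (cB (tC hN hk hMh1 hP4 c ha a (wC hN hk c w) cf) (x0 ℓ Mh k c.1) (hx0 hpl) (hfit hN hMh1 hP4 hMha c ha hpl)).W (eB (tC hN hk hMh1 hP4 c ha a (wC hN hk c w) cf) (x0 ℓ Mh k c.1))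
          (pairOp (eB (tC hN hk hMh1 hP4 c ha a (wC hN hk c w) cf) (x0 ℓ Mh k c.1) c₁) (eB (tC hN hk hMh1 hP4 c ha a (wC hN hk c w) cf) (x0 ℓ Mh k c.1) c₂) * onFun (tC hN hk hMh1 hP4 c ha a (wC hN hk c w) cf).D.G)) *
        TB (vch Mh k (svec ℓ k c.1.1 c.1.2)) := by
  rw [Gl_eq, ← TB_neg_mul_pairOp_mul_TB (vch Mh k (svec ℓ k c.1.1 c.1.2)) c₁ c₂, conj_mul, mul_smul_comm,
    transplant_pairOp_mul (W := (cB (tC hN hk hMh1 hP4 c ha a (wC hN hk c w) cf) (x0 ℓ Mh k c.1) (hx0 hpl) (hfit hN hMh1 hP4 hMha c ha hpl)).W) (e := eB (tC hN hk hMh1 hP4 c ha a (wC hN hk c w) cf) (x0 ℓ Mh k c.1))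
      (cB (tC hN hk hMh1 hP4 c ha a (wC hN hk c w) cf) (x0 ℓ Mh k c.1) (hx0 hpl) (hfit hN hMh1 hP4 hMha c ha hpl)).inj _ hc₁ hc₂]

end Identity

/-! ## §2  `hHEGin`: the pair majorant of `∇_νG_□` of the cube, input-localised over `□⁺`, global decay, print's prefactor -/

section Inputs

/-- **`hHEGin` FOR THE CUBE (INPUT-LOCALISED, GLOBAL DECAY) — THE HÖLDER TWIN OF r03's `hEGin_cube`**: there is `δ_H > 0` and for every `0 ≤ α < 1` a
constant `C_H ≥ 0` (on `d, L, a₀, a₁, α`) such that on every V1 global torus (`L ≥ 5`, `M_h ≥ 2`, `R ≥ 2L²`), for every placed cube `□`, weights,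
fine factor, direction `ν` and window bonds `c₁, c₂` of the same direction with charted initial points at sup-distance `≤ L^{j_t}` on `T_□`:
`InMajorant (geomT D) (blkV1 hN D) (P_{c₁+v,c₂+v}·(E_(ν,+)·G_□)) (□⁺) (C_H·t^α·(L^{j(y)}/c′)²·e^{−δ_H d_T(y,y′)})`, `t = |ec₁ − ec₂|_∞/L^{j_t}` —
Prop. 2.5's Hölder member (1.111) for `G_□`, read on the global lattice through the window.
[cite: Balaban1984PropagatorsII, (2.133) p.247, Prop. 2.5 p.246, (2.137) p.247, (2.90)–(2.94) p.239; Balaban1984PropagatorsI, (1.111) p.35] -/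
theorem hHEGin_cube (d ℓ : ℕ) (hd : 1 ≤ d + 1) (hL : Odd (ℓ + 1) ∧ 1 < ℓ + 1) {a₀ a₁ : ℝ} (ha₀ : 0 < a₀) (ha₁ : a₀ ≤ a₁) :
    ∃ δH : ℝ, 0 < δH ∧ ∀ α : ℝ, 0 ≤ α → α < 1 → ∃ CH : ℝ, 0 ≤ CH ∧ ∀ (m K : ℕ) {Mh k R : ℕ} {P' : Fin (d + 1) → ℕ}
      (hN : ∀ μ, N0 ℓ Mh k P' μ = (PV d ℓ m K hd hL).sitesPerDir 0) (D : TDomains d ℓ Mh k P' R) (hk : k ≤ m + K)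
      (hMh1 : 1 ≤ Mh) (hP4 : ∀ μ, 4 ≤ P' μ) {a : ℕ} (hMha : Mh = (ℓ + 1) ^ a) (_ : 2 ≤ Mh) (_ : 2 * (ℓ + 1) ^ 2 ≤ R) (_ : 4 ≤ ℓ)
      (c : ↥(cubes D.toDomains)) (hpl : Placed ℓ k P' c.1) (w : BondIdx (domT hN D hk) → ℝ) (cf : ℝ) (ν : Fin (d + 1))
      (c₁ c₂ : PBond (PV d ℓ m K hd hL) 0)
      (_ : c₁ ∈ (cB (tC hN hk hMh1 hP4 c ha₁ a (wC hN hk c w) cf) (x0 ℓ Mh k c.1) (hx0 hpl) (hfit hN hMh1 hP4 hMha c ha₁ hpl)).W)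
      (_ : c₂ ∈ (cB (tC hN hk hMh1 hP4 c ha₁ a (wC hN hk c w) cf) (x0 ℓ Mh k c.1) (hx0 hpl) (hfit hN hMh1 hP4 hMha c ha₁ hpl)).W)
      (_ : c₁.dir = c₂.dir)
      (_ : supDist (eB (tC hN hk hMh1 hP4 c ha₁ a (wC hN hk c w) cf) (x0 ℓ Mh k c.1) c₁).src
        (eB (tC hN hk hMh1 hP4 c ha₁ a (wC hN hk c w) cf) (x0 ℓ Mh k c.1) c₂).src ≤ (ℓ + 1) ^ (tC hN hk hMh1 hP4 c ha₁ a (wC hN hk c w) cf).j),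
      InMajorant (g := geomT D) (blkV1 hN D)
        (pairOp (c₁.translate (vch Mh k (svec ℓ k c.1.1 c.1.2))) (c₂.translate (vch Mh k (svec ℓ k c.1.1 c.1.2))) *
          (EC hN hk hMh1 hP4 hMha c ha₁ hpl w cf (ν, true) * Gl hN hk hMh1 hP4 hMha c ha₁ hpl w cf)) (ST D hMh1 hP4 c)
        (fun y y' => CH * (((supDist (eB (tC hN hk hMh1 hP4 c ha₁ a (wC hN hk c w) cf) (x0 ℓ Mh k c.1) c₁).src (eB (tC hN hk hMh1 hP4 c ha₁ a (wC hN hk c w) cf) (x0 ℓ Mh k c.1) c₂).src : ℕ) : ℝ) / (((ℓ + 1 : ℕ) : ℝ)) ^ (tC hN hk hMh1 hP4 c ha₁ a (wC hN hk c w) cf).j) ^ α *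
          pref cf y * Real.exp (-(δH * (geomT D).dist y y'))) := by
  obtain ⟨δ, hδ, hmemα⟩ := holder2137_member d (ℓ + 1) hd hL ha₀ ha₁
  refine ⟨δ / (((d : ℝ) + 1) * ((9 : ℕ) : ℝ)), by positivity, fun α hα0 hα1 => ?_⟩
  obtain ⟨C, hC, hmem⟩ := hmemα α hα0 hα1
  refine ⟨(((ℓ + 1) ^ (d + 1) : ℕ) : ℝ) * (C * Real.exp (δ * (((d : ℝ) + 1) + ((d : ℝ) + 1)) / (((d : ℝ) + 1) * ((9 : ℕ) : ℝ)))), by positivity, ?_⟩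
  intro m K Mh k R P' hN D hk hMh1 hP4 a hMha hMh hR2 hℓ c hpl w cf ν c₁ c₂ hc₁ hc₂ hdir hle
  have hP : ∀ μ, 1 ≤ P' μ := one_le_of_four_le hP4
  -- the relative distance factor `t^α ≥ 0` of the pair (a constant for the transport)
  have hτ : 0 ≤ (((supDist (eB (tC hN hk hMh1 hP4 c ha₁ a (wC hN hk c w) cf) (x0 ℓ Mh k c.1) c₁).src (eB (tC hN hk hMh1 hP4 c ha₁ a (wC hN hk c w) cf) (x0 ℓ Mh k c.1) c₂).src : ℕ) : ℝ) / (((ℓ + 1 : ℕ) : ℝ)) ^ (tC hN hk hMh1 hP4 c ha₁ a (wC hN hk c w) cf).j) ^ α :=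
    Real.rpow_nonneg (by positivity) _
  -- the member's pair majorant, constant `C·t^α`, rate `δ`
  have hT' := hmem (tC hN hk hMh1 hP4 c ha₁ a (wC hN hk c w) cf) 0 0 ν (eB (tC hN hk hMh1 hP4 c ha₁ a (wC hN hk c w) cf) (x0 ℓ Mh k c.1) c₁)
    (eB (tC hN hk hMh1 hP4 c ha₁ a (wC hN hk c w) cf) (x0 ℓ Mh k c.1) c₂) hdir hle
  have h1 := inDecay_window_V1 (t := tC hN hk hMh1 hP4 c ha₁ a (wC hN hk c w) cf) (x₀ := x0 ℓ Mh k c.1) (hx₀ := hx0 hpl)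
    (hfit := hfit hN hMh1 hP4 hMha c ha₁ hpl) hN (D.chart (svec ℓ k c.1.1 c.1.2)) (mul_nonneg hC hτ) hδ.le hT' hMh1 hP
    (hdiv_cube hN hk hMh1 hP4 c ha₁ (wC hN hk c w) cf) (hlev_full hN hk hMh1 hP4 hMha c ha₁ hR2 (wC hN hk c w) cf) (C := 9) (by norm_num)
    (SQ hMh1 hP4 c) (fun b _ hbS => hband_cube hN hk hMh1 hP4 hMha c ha₁ hℓ hMh hR2 (wC hN hk c w) cf b hbS)
  have h2 := inMajorant_smul_of_le_on (blkV1 hN (D.chart (svec ℓ k c.1.1 c.1.2))) h1 _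
    (transplant_off hN hk hMh1 hP4 hMha c ha₁ hpl (wC hN hk c w) cf _) (inv_nonneg.2 (sc_nonneg hMh1 hP4 c cf))
    (K' := fun y y' => (((ℓ + 1) ^ (d + 1) : ℕ) : ℝ) * (C * (((supDist (eB (tC hN hk hMh1 hP4 c ha₁ a (wC hN hk c w) cf) (x0 ℓ Mh k c.1) c₁).src (eB (tC hN hk hMh1 hP4 c ha₁ a (wC hN hk c w) cf) (x0 ℓ Mh k c.1) c₂).src : ℕ) : ℝ) / (((ℓ + 1 : ℕ) : ℝ)) ^ (tC hN hk hMh1 hP4 c ha₁ a (wC hN hk c w) cf).j) ^ α * Real.exp (δ * (((d : ℝ) + 1) + ((d : ℝ) + 1)) / (((d : ℝ) + 1) * ((9 : ℕ) : ℝ)))) *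
      pref cf y * Real.exp (-(δ / (((d : ℝ) + 1) * ((9 : ℕ) : ℝ)) * (geomT (D.chart (svec ℓ k c.1.1 c.1.2))).dist y y')))
    (fun a b => by have := pref_nonneg cf a; positivity)
    (fun b hb y _ => smul_kernel_le (sc_inv_le_pref hN hk hMh1 hP4 hMha c ha₁ hR2 hpl (wC hN hk c w) cf hb) (by positivity) (by positivity)
      (Real.exp_nonneg _))
  have h3 := inMajorant_conj_chart hN D hMh1 hP (svec ℓ k c.1.1 c.1.2) h2
    (K' := fun y y' => (((ℓ + 1) ^ (d + 1) : ℕ) : ℝ) * (C * (((supDist (eB (tC hN hk hMh1 hP4 c ha₁ a (wC hN hk c w) cf) (x0 ℓ Mh k c.1) c₁).src (eB (tC hN hk hMh1 hP4 c ha₁ a (wC hN hk c w) cf) (x0 ℓ Mh k c.1) c₂).src : ℕ) : ℝ) / (((ℓ + 1 : ℕ) : ℝ)) ^ (tC hN hk hMh1 hP4 c ha₁ a (wC hN hk c w) cf).j) ^ α * Real.exp (δ * (((d : ℝ) + 1) + ((d : ℝ) + 1)) / (((d : ℝ) + 1) * ((9 : ℕ) : ℝ)))) *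
      pref cf y * Real.exp (-(δ / (((d : ℝ) + 1) * ((9 : ℕ) : ℝ)) * (geomT D).dist y y')))
    (fun a b => le_of_eq (kernel_blkMap D hMh1 hP (svec ℓ k c.1.1 c.1.2) (fun n => ((((ℓ + 1 : ℕ) : ℝ)) ^ n / cf) ^ 2) _ _ a b))
  rw [pairOp_translate_mul_EC_mul_Gl_eq hN hk hMh1 hP4 hMha c ha₁ hpl w cf ν hc₁ hc₂]
  refine inMajorant_mono _ (inMajorant_congr_set _ (mem_blkMap_image_SQ hMh1 hP4 c) h3) fun y y' _ => le_of_eq ?_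
  ring

/-- **`hHGin` FOR THE CUBE: THE PAIR MAJORANT OF `G_□` ITSELF** (Lipschitz in the output; the partner of the `(∇h_□)·G_□·h_□` term of the leg): there are
`δ_H > 0`, `C_H ≥ 0` (on `d, L, a₀, a₁`) such that on every admissible V1 torus, for every placed cube, weights, fine factor and window bonds `c₁, c₂`
of the same direction with charted initial points at sup-distance `≤ L^{j_t}` on `T_□`:
`InMajorant (geomT D) (blkV1 hN D) (P_{c₁+v,c₂+v}·G_□) (□⁺) (C_H·t·(L^{j(y)}/c′)²·e^{−δ_H d_T(y,y′)})`, `t = |ec₁ − ec₂|_∞/L^{j_t}`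
(this seat's `holderG_member` through r03's band bridge, as in `hHEGin_cube`).
[cite: Balaban1984PropagatorsII, (2.133) p.247, Prop. 2.5 p.246, (2.90)–(2.94) p.239; Balaban1984PropagatorsI, (1.110) p.35] -/
theorem hHGin_cube (d ℓ : ℕ) (hd : 1 ≤ d + 1) (hL : Odd (ℓ + 1) ∧ 1 < ℓ + 1) {a₀ a₁ : ℝ} (ha₀ : 0 < a₀) (ha₁ : a₀ ≤ a₁) :
    ∃ δH : ℝ, 0 < δH ∧ ∃ CH : ℝ, 0 ≤ CH ∧ ∀ (m K : ℕ) {Mh k R : ℕ} {P' : Fin (d + 1) → ℕ}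
      (hN : ∀ μ, N0 ℓ Mh k P' μ = (PV d ℓ m K hd hL).sitesPerDir 0) (D : TDomains d ℓ Mh k P' R) (hk : k ≤ m + K)
      (hMh1 : 1 ≤ Mh) (hP4 : ∀ μ, 4 ≤ P' μ) {a : ℕ} (hMha : Mh = (ℓ + 1) ^ a) (_ : 2 ≤ Mh) (_ : 2 * (ℓ + 1) ^ 2 ≤ R) (_ : 4 ≤ ℓ)
      (c : ↥(cubes D.toDomains)) (hpl : Placed ℓ k P' c.1) (w : BondIdx (domT hN D hk) → ℝ) (cf : ℝ)
      (c₁ c₂ : PBond (PV d ℓ m K hd hL) 0) (_ : c₁ ∈ (cB (tC hN hk hMh1 hP4 c ha₁ a (wC hN hk c w) cf) (x0 ℓ Mh k c.1) (hx0 hpl) (hfit hN hMh1 hP4 hMha c ha₁ hpl)).W) (_ : c₂ ∈ (cB (tC hN hk hMh1 hP4 c ha₁ a (wC hN hk c w) cf) (x0 ℓ Mh k c.1) (hx0 hpl) (hfit hN hMh1 hP4 hMha c ha₁ hpl)).W) (_ : c₁.dir = c₂.dir)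
      (_ : supDist (eB (tC hN hk hMh1 hP4 c ha₁ a (wC hN hk c w) cf) (x0 ℓ Mh k c.1) c₁).src (eB (tC hN hk hMh1 hP4 c ha₁ a (wC hN hk c w) cf) (x0 ℓ Mh k c.1) c₂).src ≤ (ℓ + 1) ^ (tC hN hk hMh1 hP4 c ha₁ a (wC hN hk c w) cf).j),
      InMajorant (g := geomT D) (blkV1 hN D)
        (pairOp (c₁.translate (vch Mh k (svec ℓ k c.1.1 c.1.2))) (c₂.translate (vch Mh k (svec ℓ k c.1.1 c.1.2))) *
          Gl hN hk hMh1 hP4 hMha c ha₁ hpl w cf) (ST D hMh1 hP4 c)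
        (fun y y' => CH * (((supDist (eB (tC hN hk hMh1 hP4 c ha₁ a (wC hN hk c w) cf) (x0 ℓ Mh k c.1) c₁).src (eB (tC hN hk hMh1 hP4 c ha₁ a (wC hN hk c w) cf) (x0 ℓ Mh k c.1) c₂).src : ℕ) : ℝ) / (((ℓ + 1 : ℕ) : ℝ)) ^ (tC hN hk hMh1 hP4 c ha₁ a (wC hN hk c w) cf).j) * pref cf y * Real.exp (-(δH * (geomT D).dist y y'))) := by
  obtain ⟨δ, hδ, C, hC, hmem⟩ := holderG_member d (ℓ + 1) hd hL ha₀ ha₁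
  refine ⟨δ / (((d : ℝ) + 1) * ((9 : ℕ) : ℝ)), by positivity, (((ℓ + 1) ^ (d + 1) : ℕ) : ℝ) * (C * Real.exp (δ * (((d : ℝ) + 1) + ((d : ℝ) + 1)) / (((d : ℝ) + 1) * ((9 : ℕ) : ℝ)))), by positivity, ?_⟩
  intro m K Mh k R P' hN D hk hMh1 hP4 a hMha hMh hR2 hℓ c hpl w cf c₁ c₂ hc₁ hc₂ hdir hle
  have hP : ∀ μ, 1 ≤ P' μ := one_le_of_four_le hP4
  have hτ : 0 ≤ (((supDist (eB (tC hN hk hMh1 hP4 c ha₁ a (wC hN hk c w) cf) (x0 ℓ Mh k c.1) c₁).src (eB (tC hN hk hMh1 hP4 c ha₁ a (wC hN hk c w) cf) (x0 ℓ Mh k c.1) c₂).src : ℕ) : ℝ) / (((ℓ + 1 : ℕ) : ℝ)) ^ (tC hN hk hMh1 hP4 c ha₁ a (wC hN hk c w) cf).j) := by positivity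
  have hT' := hmem (tC hN hk hMh1 hP4 c ha₁ a (wC hN hk c w) cf) 0 0 (eB (tC hN hk hMh1 hP4 c ha₁ a (wC hN hk c w) cf) (x0 ℓ Mh k c.1) c₁) (eB (tC hN hk hMh1 hP4 c ha₁ a (wC hN hk c w) cf) (x0 ℓ Mh k c.1) c₂) hdir hle
  have h1 := inDecay_window_V1 (t := (tC hN hk hMh1 hP4 c ha₁ a (wC hN hk c w) cf)) (x₀ := x0 ℓ Mh k c.1) (hx₀ := hx0 hpl)
    (hfit := hfit hN hMh1 hP4 hMha c ha₁ hpl) hN (D.chart (svec ℓ k c.1.1 c.1.2)) (mul_nonneg hC hτ) hδ.le hT' hMh1 hP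
    (hdiv_cube hN hk hMh1 hP4 c ha₁ (wC hN hk c w) cf) (hlev_full hN hk hMh1 hP4 hMha c ha₁ hR2 (wC hN hk c w) cf) (C := 9) (by norm_num)
    (SQ hMh1 hP4 c) (fun b _ hbS => hband_cube hN hk hMh1 hP4 hMha c ha₁ hℓ hMh hR2 (wC hN hk c w) cf b hbS)
  have h2 := inMajorant_smul_of_le_on (blkV1 hN (D.chart (svec ℓ k c.1.1 c.1.2))) h1 _
    (transplant_off hN hk hMh1 hP4 hMha c ha₁ hpl (wC hN hk c w) cf _) (inv_nonneg.2 (sc_nonneg hMh1 hP4 c cf))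
    (K' := fun y y' => (((ℓ + 1) ^ (d + 1) : ℕ) : ℝ) * (C * (((supDist (eB (tC hN hk hMh1 hP4 c ha₁ a (wC hN hk c w) cf) (x0 ℓ Mh k c.1) c₁).src (eB (tC hN hk hMh1 hP4 c ha₁ a (wC hN hk c w) cf) (x0 ℓ Mh k c.1) c₂).src : ℕ) : ℝ) / (((ℓ + 1 : ℕ) : ℝ)) ^ (tC hN hk hMh1 hP4 c ha₁ a (wC hN hk c w) cf).j) * Real.exp (δ * (((d : ℝ) + 1) + ((d : ℝ) + 1)) / (((d : ℝ) + 1) * ((9 : ℕ) : ℝ)))) *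
      pref cf y * Real.exp (-(δ / (((d : ℝ) + 1) * ((9 : ℕ) : ℝ)) * (geomT (D.chart (svec ℓ k c.1.1 c.1.2))).dist y y')))
    (fun a b => by have := pref_nonneg cf a; positivity)
    (fun b hb y _ => smul_kernel_le (sc_inv_le_pref hN hk hMh1 hP4 hMha c ha₁ hR2 hpl (wC hN hk c w) cf hb) (by positivity) (by positivity)
      (Real.exp_nonneg _))
  have h3 := inMajorant_conj_chart hN D hMh1 hP (svec ℓ k c.1.1 c.1.2) h2
    (K' := fun y y' => (((ℓ + 1) ^ (d + 1) : ℕ) : ℝ) * (C * (((supDist (eB (tC hN hk hMh1 hP4 c ha₁ a (wC hN hk c w) cf) (x0 ℓ Mh k c.1) c₁).src (eB (tC hN hk hMh1 hP4 c ha₁ a (wC hN hk c w) cf) (x0 ℓ Mh k c.1) c₂).src : ℕ) : ℝ) / (((ℓ + 1 : ℕ) : ℝ)) ^ (tC hN hk hMh1 hP4 c ha₁ a (wC hN hk c w) cf).j) * Real.exp (δ * (((d : ℝ) + 1) + ((d : ℝ) + 1)) / (((d : ℝ) + 1) * ((9 : ℕ) : ℝ)))) *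
      pref cf y * Real.exp (-(δ / (((d : ℝ) + 1) * ((9 : ℕ) : ℝ)) * (geomT D).dist y y')))
    (fun a b => le_of_eq (kernel_blkMap D hMh1 hP (svec ℓ k c.1.1 c.1.2) (fun n => ((((ℓ + 1 : ℕ) : ℝ)) ^ n / cf) ^ 2) _ _ a b))
  rw [pairOp_translate_mul_Gl_eq hN hk hMh1 hP4 hMha c ha₁ hpl w cf hc₁ hc₂]
  refine inMajorant_mono _ (inMajorant_congr_set _ (mem_blkMap_image_SQ hMh1 hP4 c) h3) fun y y' _ => le_of_eq ?_
  ring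

end Inputs

end Literature.MathematicalPhysics.QuantumFieldTheory.Balaban1983to89.B6CubeHolderInDecayV1

end
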